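import Literature.Probability.Percolation.HierarchicalPercolation
import Literature.Probability.Percolation.UniversalTightness
import HarnessLib

/-!
# Hierarchical long-range percolation: typical maxima `M_B`, good blocks, Lemma 2.1 (Hutchcroft 2022, §2.2)

Topic `Literature/Probability/Percolation`. Definitions and first lemmas of Hutchcroft 2022, §2.2
"The maximum cluster size" (for the named fact `Hutchcroft2022_twoPoint_volumeTail`), on the
labelled space of `HierarchicalPercolation.lean`:

* `etaLaw B` (law of `η_B`, `= kernelPercolation J_{σ,B} β`, `etaLaw_eq`), `Mblock` (`M_B`, the
  typical value of `|K^max_B|`, via `typicalMax`), `expMax` (`E|K^max_B|`), `sumConn`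
  (`Σ_{x,y ∈ B} P(x ↔ y in η_B)`), `IsGood` ((2.8)–(2.9)), `IsAncestrallyGood`;
* the universal tightness inequalities (2.5)–(2.7) for `η_B` (wrappers of `UniversalTightness.lean`
  through `etaLaw_eq`): `etaLaw_real_clusterMaxIn_ge_le`, `etaLaw_real_clusterMaxIn_lt_le`,
  `etaLaw_real_clusterCapIn_ge_le`, `expMax_le_and_ge`; `lt_typicalMax_of_exp_lt_real`;
* **Lemma 2.1** `card_good_children_ge` (at least `L^d - ⌊L^d/2⌋` good children) via the counting
  lemma `card_filter_not_dominated_le`;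
* `hLevel_eq_succ_of_children` (pairs across distinct children of `σ(B)` are pairs of `σ(B)`),
  `mem_aboveFree_child_iff` / `aboveFree_eq_of_children` ("`η_B = η_{B'}` for siblings");
* `prodBernoulli_real_iUnion_inter_le` — the conditional union bound through a finite set of
  coordinates (the elementary form of the conditioning on `𝓕 = σ(η_B)` in Lemmas 2.6 and 2.8);
* `maxVertex`, `maxTrace` (the `𝓕`-measurable selection `D_i` of a maximal cluster trace, "we break
  ties … using an enumeration … chosen in advance"), `card_maxTrace`.

## References

* [Hutchcroft2022] T. Hutchcroft, J. Math. Phys. 63 (2022), arXiv:2202.07634, §2.2 (pp. 7–10):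
  `M_B`, (2.5)–(2.7), (2.8)–(2.9), Lemma 2.1, ancestrally good blocks, proof of Lemma 2.6.
-/

noncomputable section

namespace Literature.Probability.Percolation

open Finset Literature.Probability.LatticeModels

variable {d : ℕ}

/-! ### The law of `η_B`, typical maxima, good blocks -/

section GoodBlocks

open MeasureTheory

variable {L : ℕ} {o : ℕ → Site d}

/-- **The law of `η_B`** under `P_{β,σ}` (a long-range percolation with kernel `J_{σ,B}`,
`hierLaw_map_etaCfg`). [cite: Hutchcroft2022, §2.1 (p. 7)] -/
def etaLaw (J : Sym2 (Site d) → ℝ) (L : ℕ) (o : ℕ → Site d) (c α β : ℝ) (B : Finset (Site d)) :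
    Measure (BondConfig (Site d)) :=
  (hierLaw J L o c α β).map (etaCfg (aboveFree L o B))

/-- `etaLaw` is a probability measure. [folklore] -/
instance instIsProbabilityMeasureEtaLaw (J : Sym2 (Site d) → ℝ) (L : ℕ) (o : ℕ → Site d)
    (c α β : ℝ) (B : Finset (Site d)) : IsProbabilityMeasure (etaLaw J L o c α β B) :=
  Measure.isProbabilityMeasure_map (measurable_etaCfg _).aemeasurable

/-- **`M_B`**, the typical value of `|K^max_B| = max{|K ∩ B| : K a cluster of η_B}`
("`M_B := min{m ≥ 1 : P_{β,σ}(|K^max_B| ≥ m) ≤ 1/e}`"; here `typicalMax`, whose minimum over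
`n ≥ 0` has the same value since the probabilities at `n = 0, 1` equal `1`).
[cite: Hutchcroft2022, §2.2 (p. 7, M_B)] -/
def Mblock (J : Sym2 (Site d) → ℝ) (L : ℕ) (o : ℕ → Site d) (c α β : ℝ) (B : Finset (Site d)) : ℕ :=
  typicalMax (etaLaw J L o c α β B) B

/-- **`E_{β,σ}|K^max_B|`.** [cite: Hutchcroft2022, §2.2 (2.7)] -/
def expMax (J : Sym2 (Site d) → ℝ) (L : ℕ) (o : ℕ → Site d) (c α β : ℝ) (B : Finset (Site d)) : ℝ :=
  ∫ ω, (clusterMaxIn B ω : ℝ) ∂(etaLaw J L o c α β B)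

/-- **`Σ_{x,y ∈ B} P_{β,σ}(x ↔ y in η_B)`** (the quantity of (2.9) and Prop. 2.7; by (2.11) it equals
`Σ_{x ∈ B} E|K_B(x) ∩ B|`). [cite: Hutchcroft2022, §2.2 (2.9) and (2.11)] -/
def sumConn (J : Sym2 (Site d) → ℝ) (L : ℕ) (o : ℕ → Site d) (c α β : ℝ) (B : Finset (Site d)) : ℝ :=
  ∑ x ∈ B, ∑ y ∈ B, (etaLaw J L o c α β B).real (openConn x y)

/-- **Good blocks** (Hutchcroft 2022, (2.8)–(2.9)): the child `B` of `B_{n+1}(x)` is good if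
`E|K^max_B| ≤ E|K^max_{B'}|` for at least `⌊L^d/2⌋ - 1` siblings `B'` and
`Σ_{x,y∈B} P(x ↔ y in η_B) ≤ Σ_{x,y∈B'} P(x ↔ y in η_{B'})` for at least one sibling `B'`.
[cite: Hutchcroft2022, §2.2 (2.8)–(2.9)] -/
def IsGood (J : Sym2 (Site d) → ℝ) (L : ℕ) (o : ℕ → Site d) (c α β : ℝ) (n : ℕ) (x : Site d)
    (B : Finset (Site d)) : Prop :=
  B ∈ children L o n x ∧
    L ^ d / 2 - 1 ≤ ((children L o n x).filter fun B' => B' ≠ B ∧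
      expMax J L o c α β B ≤ expMax J L o c α β B').card ∧
    1 ≤ ((children L o n x).filter fun B' => B' ≠ B ∧
      sumConn J L o c α β B ≤ sumConn J L o c α β B').card

/-- **Counting lemma behind Lemma 2.1**: in a finite family scored by `E` and `S`, the members that
are NOT dominated in `E` by at least `k` others number at most `k`, and at most one member strictly
exceeds all others in `S`. Hence at most `k + 1` members fail to be good. [folklore] -/
theorem card_filter_not_dominated_le {ι : Type*} [DecidableEq ι] (s : Finset ι) (E : ι → ℝ) (k : ℕ) :
    (s.filter fun i => (s.filter fun j => j ≠ i ∧ E i ≤ E j).card < k).card ≤ k := by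
  classical
  set F := s.filter fun i => (s.filter fun j => j ≠ i ∧ E i ≤ E j).card < k with hF
  rcases F.eq_empty_or_nonempty with hFe | hFne
  · rw [hFe]; simp
  · -- a member of `F` with minimal score: all other members of `F` dominate it
    obtain ⟨i₀, hi₀, hmin⟩ := F.exists_min_image E hFne
    have hsub : F.erase i₀ ⊆ s.filter fun j => j ≠ i₀ ∧ E i₀ ≤ E j := by
      intro j hj
      rw [Finset.mem_erase] at hj
      exact Finset.mem_filter.2 ⟨(Finset.mem_filter.1 hj.2).1, hj.1, hmin j hj.2⟩
    have h1 := Finset.card_le_card hsub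
    have h2 : (s.filter fun j => j ≠ i₀ ∧ E i₀ ≤ E j).card < k := (Finset.mem_filter.1 hi₀).2
    rw [Finset.card_erase_of_mem hi₀] at h1
    have : 0 < F.card := Finset.card_pos.2 hFne
    omega

/-- At most one member strictly exceeds all the others. [folklore] -/
theorem card_filter_strict_max_le_one {ι : Type*} [DecidableEq ι] (s : Finset ι) (S : ι → ℝ) :
    (s.filter fun i => (s.filter fun j => j ≠ i ∧ S i ≤ S j).card < 1).card ≤ 1 :=
  card_filter_not_dominated_le s S 1

open Classical in
/-- **Lemma 2.1**: every block `B_{n+1}(x)` has at least `L^d - ⌊L^d/2⌋ ≥ L^d/2` good children (of its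
`L^d` children at most `⌊L^d/2⌋ - 1` violate (2.8) and at most one violates (2.9)).
[cite: Hutchcroft2022, Lemma 2.1] -/
theorem card_good_children_ge (hL : 2 ≤ L) (hd : 1 ≤ d) (ho : IsHierOffset L o)
    (J : Sym2 (Site d) → ℝ) (c α β : ℝ) (n : ℕ) (x : Site d) :
    L ^ d - L ^ d / 2 ≤ ((children L o n x).filter fun B => IsGood J L o c α β n x B).card := by
  classical
  have hL1 : 1 ≤ L := le_trans (by norm_num) hL
  have hN2 : 2 ≤ L ^ d := le_trans (by simpa using Nat.pow_le_pow_left hL 1) (Nat.pow_le_pow_right (by omega) hd)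
  set C := children L o n x with hC
  have hcard : C.card = L ^ d := card_children hL1 o ho n x
  -- the bad children
  set bad₁ := C.filter fun B => (C.filter fun B' => B' ≠ B ∧
    expMax J L o c α β B ≤ expMax J L o c α β B').card < L ^ d / 2 - 1 with hbad₁
  set bad₂ := C.filter fun B => (C.filter fun B' => B' ≠ B ∧
    sumConn J L o c α β B ≤ sumConn J L o c α β B').card < 1 with hbad₂
  have h1 : bad₁.card ≤ L ^ d / 2 - 1 := card_filter_not_dominated_le C _ _
  have h2 : bad₂.card ≤ 1 := card_filter_strict_max_le_one C _
  have hgood : C.filter (fun B => IsGood J L o c α β n x B) = C \ (bad₁ ∪ bad₂) := by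
    ext B
    simp only [IsGood, Finset.mem_filter, Finset.mem_sdiff, Finset.mem_union, hbad₁, hbad₂, ← hC]
    constructor
    · rintro ⟨hB, -, hE, hS⟩
      exact ⟨hB, fun h => h.elim (fun h => absurd hE (not_le.2 h.2)) fun h => absurd hS (not_le.2 h.2)⟩
    · rintro ⟨hB, h⟩
      push Not at h
      exact ⟨hB, hB, h.1 hB, h.2 hB⟩
  have hsub : bad₁ ∪ bad₂ ⊆ C :=
    Finset.union_subset (Finset.filter_subset _ _) (Finset.filter_subset _ _)
  have hgoodcard : (C.filter fun B => IsGood J L o c α β n x B).card = C.card - (bad₁ ∪ bad₂).card := by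
    rw [hgood]; exact Finset.card_sdiff_of_subset hsub
  have hu := Finset.card_union_le bad₁ bad₂
  rw [hgoodcard, hcard]
  generalize hN : L ^ d = N at h1 hN2 ⊢
  omega

end GoodBlocks

/-! ### Universal tightness for `η_B`, level of cross pairs, typical-value comparison -/

section EtaTightness

open MeasureTheory

variable {L : ℕ} (hL : 2 ≤ L) (hd : 1 ≤ d) {o : ℕ → Site d} (ho : IsHierOffset L o)
  {J : Sym2 (Site d) → ℝ} {c α β : ℝ} (hc : 0 ≤ c) (hα : 0 ≤ (d : ℝ) + α) (hJ0 : ∀ e, 0 ≤ J e)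
  (hJ : HasPowerLowerBound J c α) (hβ : 0 ≤ β)

include hL ho hc hα hJ0 hJ hβ in
open Classical in
/-- `etaLaw B` is the long-range percolation with kernel `J_{σ,B} = 𝟙_{A_B} J + 𝟙_{A_Bᶜ} R_σ`.
[cite: Hutchcroft2022, §2.1 (p. 7, J_{σ,B})] -/
theorem etaLaw_eq (B : Finset (Site d)) :
    etaLaw J L o c α β B = kernelPercolation
      (fun e => if e ∈ aboveFree L o B then J e else remKernel J L o c α e) β := by
  have hL1 : 1 ≤ L := le_trans (by norm_num) hL
  unfold etaLaw
  convert hierLaw_map_etaCfg hL1 ho hc hα hJ0 hJ hβ (aboveFree L o B) using 4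

include hL ho hc hα hJ0 hJ hβ in
/-- **(2.5), upper tail, for `η_B`**: `P_{β,σ}(|K^max_B| ≥ a M_B) ≤ exp((1-a)/2)` (`a ≥ 1`).
[cite: Hutchcroft2022, §2.2 (2.5)] -/
theorem etaLaw_real_clusterMaxIn_ge_le {B : Finset (Site d)} (hB : B.Nonempty) {a : ℝ} (ha : 1 ≤ a) :
    (etaLaw J L o c α β B).real {ω | a * Mblock J L o c α β B ≤ (clusterMaxIn B ω : ℝ)} ≤
      Real.exp ((1 - a) / 2) := by
  rw [Mblock, etaLaw_eq hL ho hc hα hJ0 hJ hβ]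
  exact prodBernoulli_real_clusterMaxIn_ge_le_exp _ hB ha

include hL ho hc hα hJ0 hJ hβ in
/-- **(2.5), lower tail, for `η_B`**: `P_{β,σ}(|K^max_B| < ε M_B) ≤ 8 ε`. [cite: Hutchcroft2022, §2.2 (2.5)] -/
theorem etaLaw_real_clusterMaxIn_lt_le {B : Finset (Site d)} (hB : B.Nonempty) {ε : ℝ} (hε : 0 < ε) :
    (etaLaw J L o c α β B).real {ω | (clusterMaxIn B ω : ℝ) < ε * Mblock J L o c α β B} ≤ 8 * ε := by
  rw [Mblock, etaLaw_eq hL ho hc hα hJ0 hJ hβ]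
  exact prodBernoulli_real_clusterMaxIn_lt_le _ hB hε

include hL ho hc hα hJ0 hJ hβ in
/-- **(2.6), rooted tail, for `η_B`.** [cite: Hutchcroft2022, §2.2 (2.6)] -/
theorem etaLaw_real_clusterCapIn_ge_le {B : Finset (Site d)} (hB : B.Nonempty) (u : Site d) {a : ℝ}
    (ha : 1 ≤ a) :
    (etaLaw J L o c α β B).real {ω | a * Mblock J L o c α β B ≤ (clusterCapIn B ω u : ℝ)} ≤
      Real.exp ((3 - a) / 2) * (etaLaw J L o c α β B).real {ω | Mblock J L o c α β B ≤ clusterCapIn B ω u} := by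
  rw [Mblock, etaLaw_eq hL ho hc hα hJ0 hJ hβ]
  exact prodBernoulli_real_clusterCapIn_ge_le_exp_mul _ hB u ha

include hL ho hc hα hJ0 hJ hβ in
/-- **(2.7) for `η_B`**: `(M_B - 1)/e ≤ E|K^max_B| ≤ 4 M_B`. [cite: Hutchcroft2022, §2.2 (2.7)] -/
theorem expMax_le_and_ge {B : Finset (Site d)} (hB : B.Nonempty) :
    ((Mblock J L o c α β B : ℝ) - 1) * Real.exp (-1) ≤ expMax J L o c α β B ∧
      expMax J L o c α β B ≤ 4 * Mblock J L o c α β B := by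
  rw [Mblock, expMax, etaLaw_eq hL ho hc hα hJ0 hJ hβ]
  exact ⟨typicalMax_sub_one_mul_exp_le_integral _ B, integral_clusterMaxIn_le_four_mul_typicalMax _ hB⟩

omit hc hα hJ0 hJ hβ in
include hL ho in
/-- **Pairs across distinct children of a block have level `n+1`**: if `a, b` lie in distinct
children of `B_{n+1}(x)` then `h_σ(a,b) = n+1` (so that they are joined by an edge of `ω_{σ(B)}`
with probability `1 - exp(-cβL^{-(d+α)(n+1)})`). [cite: Hutchcroft2022, proof of Lemma 2.6 (p. 10)] -/
theorem hLevel_eq_succ_of_children {n : ℕ} {x a b : Site d} (ha : a ∈ block L o (n + 1) x)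
    (hb : b ∈ block L o (n + 1) x) (hab : block L o n a ≠ block L o n b) :
    hLevel L o a b = n + 1 ∧ HasCommonBlock L o a b := by
  have hL1 : 1 ≤ L := le_trans (by norm_num) hL
  have hcommon : HasCommonBlock L o a b := ⟨n + 1, by
    rw [(block_eq_iff_mem hL1 o).2 ha, ← (block_eq_iff_mem hL1 o).2 hb]; exact mem_block_self hL1 o _ b⟩
  refine ⟨le_antisymm ?_ ?_, hcommon⟩
  · -- `b ∈ B_{n+1}(a)`
    have : b ∈ block L o (n + 1) a := by
      rw [(block_eq_iff_mem hL1 o).2 ha, ← (block_eq_iff_mem hL1 o).2 hb]; exact mem_block_self hL1 o _ b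
    exact ((mem_block_iff_hLevel_le hL1 o ho).1 this).2
  · -- not in a common `n`-block
    by_contra hlt
    push Not at hlt
    have hbn : b ∈ block L o n a := (mem_block_iff_hLevel_le hL1 o ho).2 ⟨hcommon, by omega⟩
    exact hab ((block_eq_iff_mem hL1 o).2 hbn).symm

/-- **Comparison with the typical value**: if `P(|K^max(Λ)| ≥ t) > e^{-1}` then `t < M(Λ)` (the
tail probabilities decrease in the threshold and `P(|K^max| ≥ M) ≤ e^{-1}`).
[cite: Hutchcroft2022, proof of Lemma 2.6 (p. 10, "so that M_{σ(B)} ≥ L^{(d+α)/2} M_B")] -/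
theorem lt_typicalMax_of_exp_lt_real {V : Type*} (μ : Measure (BondConfig V)) [IsFiniteMeasure μ]
    (Λ : Finset V) {t : ℝ}
    (h : Real.exp (-1) < μ.real {ω | t ≤ (clusterMaxIn Λ ω : ℝ)}) : t < typicalMax μ Λ := by
  by_contra hle
  push Not at hle
  have hsub' : {ω : BondConfig V | t ≤ (clusterMaxIn Λ ω : ℝ)} ⊆ {ω | typicalMax μ Λ ≤ clusterMaxIn Λ ω} := by
    intro ω hω
    simp only [Set.mem_setOf_eq] at hω ⊢
    exact_mod_cast le_trans hle hω
  have := measureReal_mono hsub' (measure_ne_top μ _)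
  linarith [real_typicalMax_le_clusterMaxIn_le μ Λ]

end EtaTightness

/-! ### Conditioning on the complement of a finite set of coordinates -/

section ConditionalBound

open MeasureTheory
open scoped ENNReal

variable {ι : Type*}

/-- **Conditional union bound through a finite set of coordinates.** Under a product Bernoulli
measure, let `T` be a finite set of coordinates, `(A_v)` a countable family of pairwise disjoint
events determined by `Tᶜ` (the values of some `σ(Tᶜ)`-measurable data together with a
`σ(Tᶜ)`-measurable event), and `(B_v)` events determined by `T` with `P(B_v) ≤ q`. Then
`P(⋃_v A_v ∩ B_v) ≤ q · P(⋃_v A_v)` — the elementary form of "conditionally on `𝓕`, … with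
probability at most …" used in the proofs of Lemma 2.6 ("the conditional probability given `𝓕`
that `D_i` is connected to `D_j` by an edge of `ω_{σ(B)}` is equal to …") and Lemma 2.8.
[cite: Hutchcroft2022, proof of Lemma 2.6 (p. 10)] -/
theorem prodBernoulli_real_iUnion_inter_le {δ : Type*} [Countable δ] (p : ι → unitInterval)
    (T : Finset ι) (A B : δ → Set (Set ι)) (hA : ∀ v, DeterminedBy (A v) (↑T : Set ι)ᶜ)
    (hB : ∀ v, DeterminedBy (B v) (↑T : Set ι)) (hAm : ∀ v, MeasurableSet (A v))
    (hBm : ∀ v, MeasurableSet (B v)) (hdisj : Pairwise fun v w => Disjoint (A v) (A w)) {q : ℝ}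
    (hq0 : 0 ≤ q) (hq : ∀ v, (prodBernoulli p).real (B v) ≤ q) :
    (prodBernoulli p).real (⋃ v, A v ∩ B v) ≤ q * (prodBernoulli p).real (⋃ v, A v) := by
  set μ := prodBernoulli p with hμ
  -- in `ℝ≥0∞`: `μ(⋃ A_v ∩ B_v) ≤ Σ μ(A_v ∩ B_v) = Σ μ(B_v) μ(A_v) ≤ q Σ μ(A_v) = q μ(⋃ A_v)`
  have hind : ∀ v, μ (A v ∩ B v) = μ (B v) * μ (A v) := by
    intro v
    rw [Set.inter_comm, ← ofReal_measureReal (measure_ne_top _ _), hμ,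
      prodBernoulli_real_inter_of_determinedBy p T (hB v) (hA v) (hBm v) (hAm v),
      ENNReal.ofReal_mul measureReal_nonneg, ofReal_measureReal (measure_ne_top _ _),
      ofReal_measureReal (measure_ne_top _ _)]
  have hE : μ (⋃ v, A v ∩ B v) ≤ ENNReal.ofReal q * μ (⋃ v, A v) := by
    calc μ (⋃ v, A v ∩ B v) ≤ ∑' v, μ (A v ∩ B v) := measure_iUnion_le _
      _ = ∑' v, μ (B v) * μ (A v) := tsum_congr hind
      _ ≤ ∑' v, ENNReal.ofReal q * μ (A v) := by
          refine ENNReal.tsum_le_tsum fun v => ?_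
          have hBq : μ (B v) ≤ ENNReal.ofReal q := by
            rw [← ofReal_measureReal (measure_ne_top _ _)]
            exact ENNReal.ofReal_le_ofReal (hq v)
          exact mul_le_mul_left hBq _
      _ = ENNReal.ofReal q * ∑' v, μ (A v) := ENNReal.tsum_mul_left
      _ = ENNReal.ofReal q * μ (⋃ v, A v) := by rw [measure_iUnion hdisj hAm]
  have := ENNReal.toReal_mono (ENNReal.mul_ne_top ENNReal.ofReal_ne_top (measure_ne_top _ _)) hE
  rw [ENNReal.toReal_mul, ENNReal.toReal_ofReal hq0] at this
  rw [measureReal_def, measureReal_def]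
  exact this

end ConditionalBound

/-! ### Siblings share `η` -/

section Siblings

variable {L : ℕ} (hL : 2 ≤ L) (hd : 1 ≤ d) {o : ℕ → Site d} (ho : IsHierOffset L o)
include hL hd ho

/-- **The selection `A_B` only depends on the parent**: for a child `B` of `B_{n+1}(x)`,
`e ∈ A_B ↔ ¬(B_{n+1}(x) ⊆ edgeBlock e)` ("`η_B = η_{B'}` when `B` and `B'` are siblings").
[cite: Hutchcroft2022, §2.1 (p. 7, "η_B = η_{B'} when B and B' are siblings")] -/
theorem mem_aboveFree_child_iff {n : ℕ} {x : Site d} {B : Finset (Site d)} (hB : B ∈ children L o n x)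
    (e : Sym2 (Site d)) : e ∈ aboveFree L o B ↔ ¬(block L o (n + 1) x ⊆ edgeBlock L o e) := by
  have hL1 : 1 ≤ L := le_trans (by norm_num) hL
  obtain ⟨y, hy, rfl⟩ := (mem_children_iff o).1 hB
  have hP : block L o (n + 1) y = block L o (n + 1) x := (block_eq_iff_mem hL1 o).2 hy
  rw [← hP]
  simp only [aboveFree, Set.mem_setOf_eq, not_iff_not]
  by_cases hprop : IsProperEdge L o e
  swap
  · have hE : edgeBlock L o e = ∅ := by rw [edgeBlock, if_neg hprop]
    rw [hE]
    constructor
    · intro h; exact absurd (h.1 (mem_block_self hL1 o n y)) (Finset.notMem_empty y)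
    · intro h; exact absurd (h (mem_block_self hL1 o (n + 1) y)) (Finset.notMem_empty y)
  · induction e using Sym2.ind with
    | h a b =>
      rw [edgeBlock_mk hL ho hprop]
      set m := hLevel L o a b
      constructor
      · intro hss
        -- `B_n(y) ⊊ B_m(a)`: then `m ≥ n+1` and the parent is contained in it
        have hsub := hss.1
        have hmn : n + 1 ≤ m := by
          have hle := level_le_of_block_subset hL hd hsub
          rcases hle.lt_or_eq with hlt | heq
          · omega
          · exfalso
            -- same level and `B_n(y) ⊆ B_n(a)` forces equality
            apply hss.2
            rw [← heq] at hsub ⊢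
            have h1 : y ∈ block L o n a := hsub (mem_block_self hL1 o n y)
            rw [(block_eq_iff_mem hL1 o).2 h1]
        rcases block_subset_or_disjoint hL1 o ho hmn a y with h | h
        · exact h
        · exfalso
          exact Finset.disjoint_left.1 h (mem_block_self hL1 o (n + 1) y) (hsub (mem_block_self hL1 o n y))
      · intro hP'
        refine Finset.ssubset_iff_subset_ne.2 ⟨(block_subset_block_succ hL1 o ho n y).trans hP', fun heq => ?_⟩
        have := Finset.card_le_card hP'
        rw [← heq] at this
        exact absurd this (not_le.2 (Finset.card_lt_card (Finset.ssubset_iff_subset_ne.2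
          ⟨block_subset_block_succ hL1 o ho n y, fun h => by
            have := level_eq_of_block_eq hL hd h; omega⟩)))

/-- Siblings have the same `η`: `aboveFree B = aboveFree B'`. [cite: Hutchcroft2022, §2.1 (p. 7)] -/
theorem aboveFree_eq_of_children {n : ℕ} {x : Site d} {B B' : Finset (Site d)}
    (hB : B ∈ children L o n x) (hB' : B' ∈ children L o n x) : aboveFree L o B = aboveFree L o B' := by
  ext e
  rw [mem_aboveFree_child_iff hL hd ho hB, mem_aboveFree_child_iff hL hd ho hB']

end Siblings

/-! ### Ancestral goodness and the maximal-trace selector -/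

section Selectors

open MeasureTheory

variable {L : ℕ} {o : ℕ → Site d}

/-- **Ancestrally good blocks**: `B_n(x)` is ancestrally good if `B_k(x)` is a good child of
`B_{k+1}(x)` for every `k ≥ n` ("good and all of its ancestors are good").
[cite: Hutchcroft2022, §2.2 (p. 8, ancestrally good)] -/
def IsAncestrallyGood (J : Sym2 (Site d) → ℝ) (L : ℕ) (o : ℕ → Site d) (c α β : ℝ) (n : ℕ)
    (x : Site d) : Prop :=
  ∀ k, n ≤ k → IsGood J L o c α β k x (block L o k x)

/-- Ancestral goodness passes to the parent. [cite: Hutchcroft2022, §2.2 (p. 8)] -/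
theorem IsAncestrallyGood.succ {J : Sym2 (Site d) → ℝ} {c α β : ℝ} {n : ℕ} {x : Site d}
    (h : IsAncestrallyGood J L o c α β n x) : IsAncestrallyGood J L o c α β (n + 1) x :=
  fun k hk => h k (by omega)

/-- Ancestral goodness passes to all ancestors. [cite: Hutchcroft2022, §2.2 (p. 8)] -/
theorem IsAncestrallyGood.mono {J : Sym2 (Site d) → ℝ} {c α β : ℝ} {m n : ℕ} {x : Site d}
    (h : IsAncestrallyGood J L o c α β n x) (hmn : n ≤ m) : IsAncestrallyGood J L o c α β m x :=
  fun k hk => h k (le_trans hmn hk)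

variable {V : Type*}

open Classical in
/-- **A vertex achieving the maximal trace** on the finite set `Λ` (the first one in a fixed
enumeration of `Λ`; an arbitrary but deterministic tie-breaking, "we break ties in an arbitrary
`𝓕`-measurable way (e.g. using an enumeration of `ℤ^d` that is chosen in advance)").
[cite: Hutchcroft2022, proof of Lemma 2.6 (p. 10)] -/
def maxVertex (Λ : Finset V) (ω : BondConfig V) : Option V :=
  (Λ.toList).find? fun v => clusterCapIn Λ ω v = clusterMaxIn Λ ω

open Classical in
/-- **The maximal trace `D`**: the trace on `Λ` of the cluster of `maxVertex` (so that `|D| =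
|K_max(Λ)|` and `D = K ∩ Λ` for a cluster `K`), `∅` if `Λ = ∅`.
[cite: Hutchcroft2022, proof of Lemma 2.6 (p. 10, the sets D_i)] -/
def maxTrace (Λ : Finset V) (ω : BondConfig V) : Finset V :=
  match maxVertex Λ ω with
  | none => ∅
  | some v => Λ.filter fun z => (openGraph ω).Reachable v z

/-- For nonempty `Λ`, `maxVertex` is some vertex of `Λ` with maximal trace. [folklore] -/
theorem exists_maxVertex_eq_some {Λ : Finset V} (hΛ : Λ.Nonempty) (ω : BondConfig V) :
    ∃ v, maxVertex Λ ω = some v ∧ v ∈ Λ ∧ clusterCapIn Λ ω v = clusterMaxIn Λ ω := by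
  classical
  obtain ⟨u, hu, hmax⟩ := exists_clusterCapIn_eq_clusterMaxIn hΛ ω
  unfold maxVertex
  cases h : (Λ.toList).find? (fun v => decide (clusterCapIn Λ ω v = clusterMaxIn Λ ω)) with
  | none =>
    exfalso
    rw [List.find?_eq_none] at h
    have := h u (Finset.mem_toList.2 hu)
    simp [hmax] at this
  | some v =>
    refine ⟨v, ?_, ?_, ?_⟩
    · simp
    · exact Finset.mem_toList.1 (List.mem_of_find?_eq_some h)
    · have := List.find?_some h
      simpa using this

/-- **The maximal trace has `|K_max(Λ)|` elements and lies in `Λ`.** [cite: Hutchcroft2022, proof of Lemma 2.6 (p. 10)] -/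
theorem card_maxTrace {Λ : Finset V} (hΛ : Λ.Nonempty) (ω : BondConfig V) :
    (maxTrace Λ ω).card = clusterMaxIn Λ ω ∧ maxTrace Λ ω ⊆ Λ ∧
      ∃ v ∈ Λ, ∀ z ∈ maxTrace Λ ω, (openGraph ω).Reachable v z := by
  classical
  obtain ⟨v, hv, hvΛ, hmax⟩ := exists_maxVertex_eq_some hΛ ω
  have hD : maxTrace Λ ω = Λ.filter fun z => (openGraph ω).Reachable v z := by
    unfold maxTrace; rw [hv]
  rw [hD]
  refine ⟨?_, Finset.filter_subset _ _, v, hvΛ, fun z hz => (Finset.mem_filter.1 hz).2⟩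
  rw [← hmax, clusterCapIn_eq]

end Selectors


end Literature.Probability.Percolation

end
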